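import Summits.QuantumFields.BalabanUV.T4Continuum.Support.NE7RepWGaugeOfDecomposition
import HarnessLib

/-!
# NE7DecompOfDirectLettersSlice — F326 §2 (`NE7RepWGaugeOfDecomposition.decomp_of_directLetters`) OVER AN ABSTRACT SLICE FAMILY `𝒯 k U♯`: the `hdecomp` body (the honest per-pair binder
# consumed by `NE7OneStepGenericSlicePath.hrep_of_hdecomp_generic` and by the whole `…Slice` chain up to `NE7HintOfSliceNormalisationSU2DecSlice.hint_SU2_of_decomposition`) FROM an EXACT
# `𝒯`-SLICE RESIDUAL REPRESENTATIVE and the two DIRECT letters (DL1)∕(DL2) of the linearised average — the kernel form of the split «supplier = nonlinear slice theorem + quadratic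
# remainder letters» of memo ROAD-G99 §3.8 (B)

Cell `pub-balaban`, sub-cell t4, lineage `b2b-balaban-t4-ne7-p1`, generation 99 (CRUX PROVER NE7 #1 = OWNER of BINDER row NE7).  F326 §2 VERBATIM except: the structure
`ResidualSliceRepT` (which hardcodes `T_♮`) is replaced by its fields as explicit hypotheses with the slice condition `X₀ − rightInvW(φ) ∈ 𝒯 k U♯` for an arbitrary family
`𝒯 : ℕ → cfg → Set dir` whose members are skew (`hTs`); the corner-triviality of the gauge is not needed and not asked.  Row NE3's right-inverse letters (R1)–(R3) BY NAME.
WHAT ([folklore]; 0 def, 0 sorry).  **`decomp_of_directLetters_generic`** — level `k+1`, `M = L^{k+1}`, `U♯ ∈ sfClass d L N ε (k+1)`, `LevelSmall d L k (ε∕M²)`, W6 regime `thetaLoc·ε < 1`,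
`ε ≤ 1`; PER PAIR: a unitary gauge `u` with `U′^{u} = U♯·e^{X₀}`, `X₀` skew `(N·M)`-periodic with `sup ≤ α₀`, the EXACT slice condition `X₀ − rightInvW(φ) ∈ 𝒯 k U♯` (`φ := dirIter L (k+1) U♯ X₀`,
for every proof argument of `rightInvW`), and the DIRECT LETTERS (DL2) `(M^d∕M⁴)·dirSq φ ≤ q₂²·‖X₀‖_w²`, (DL1) `(M^d∕M⁴)·dirL1 φ ≤ q₁·‖X₀‖_w²` ⟹ the `hdecomp` body over `𝒯` with
`X_T := X₀ − rightInvW(φ)`, `X_N := rightInvW(φ)`, `ν = √(c₁+c₂)·q₂`, `κ = ε·c₃·q₁`; and **`decomp_of_directLetters_coarse`** — the same relative to an ARBITRARY skew coarse datum `φ` (the variant `𝒯_E` needs, memo §3.9 (S1″)).  For `𝒯_E = energyBlockLandauW` this is the junction: the NONLINEAR SLICE THEOREM supplies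
`(u, X₀, α₀)` with `α₀·M ≤ α̂` (memo §3.8 (B)), the quadratic-remainder letters supply (DL1)∕(DL2).
HONEST FRAMING (page 1): bookkeeping and real arithmetic over landed theorems; the slice representative and the direct letters are HYPOTHESIS SHAPES asserted for nothing; NOT
ONE-STEP, NOT NE7; spine 0∕9; finite T⁴ rung (B)+1 — NOT infinite volume, NOT mass gap, NOT BetaPertH, NOT Clay.  Continuum YM on T⁴ ⇐ BetaPertH ∧ nine spine estimates (0/9 proved);
BetaPertH ⇐ (D1) ∧ (D4) ∧ CAP+tail; G-an2-4 gates asym, D1 and NE2/3/4.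
-/

set_option autoImplicit false

open scoped BigOperators Matrix Matrix.Norms.L2Operator
open NormedSpace Finset Set

namespace Summit.QuantumFields.BalabanUV.T4Continuum.NE7DecompOfDirectLettersSlice


open Literature.MathematicalPhysics.QuantumFieldTheory.Balaban1983to89
open B7Prop1Explicit B7Prop2Explicit
open T4AveragingDeficitWall (IsUnitaryCfg IsSkewDir SmallField vary curl curlSq dirSq dirL1)
open T4AveragingDeficitWallBoundary (IsPeriodicCfg periodBox)
open AveragingDeficitPeriodicCounting (IsPeriodicDir)
open AveragingDeficitMultiLevelPrep (LevelSmall tower TangentIter)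
open MinimalActionLevels (perWin)
open MinimalActionSandwich (admissible)
open MinimalActionRate (sfClass)
open NE3EnergyShapes (IsUnitarySite IsPeriodicSite)
open NE3EnergyWeightedShapes (energyNormW energyNormW_nonneg)
open NE3ProductPathBounds (energySq_nonneg)
open NE3EnergyHessContTwoTerm (curlSq_nonneg dirSq_nonneg)
open NE3TangentCovariantTower (dirIter)
open NE3DecomposedRepSfClass (levelRadius_rescale)
open NE3QbarIterCovLiftPrep (cruxC)
open NE3SmoothRightInverseW (rightInvW)
open NE3RightInverseSolveLetters (thetaLoc cruxC_nonneg cruxC_le_thetaLoc)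
open NE3RightInverseL2Letter (l2C l2C_nonneg)
open NE3HatInvCurlLetters (curl2C curl1C curl2C_nonneg curl1C_nonneg)
open NE3RightInverseLetters (rightInvW_R1 curlSq_rightInvW_le sum_norm_curl_rightInvW_le)
open NE3EnergyRateWSupRoutePiRInv (dirIter_skew)


noncomputable section

variable {d : ℕ} {n : Type*} [Fintype n] [DecidableEq n]

/-! ## The `hdecomp` body over `𝒯` from an exact `𝒯`-slice representative and the DIRECT letters -/

/-- **THE `hdecomp` BODY FROM THE EXACT RESIDUAL SLICE REPRESENTATIVE AND THE TWO DIRECT LETTERS** (level `k+1`, `M = L^{k+1}`, `U♯ ∈ sfClass d L N ε (k+1)`,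
`LevelSmall d L k (ε∕M²)`, W6 regime `thetaLoc·ε < 1`, `ε ≤ 1`).  PER PAIR: `ResidualSliceRepT L N (k+1) U♯ U′ u X₀ (rightInvW …(φ)) α₀` for every proof argument of
`rightInvW`, `φ := dirIter L (k+1) U♯ X₀`, and the DIRECT LETTERS (DL2) `(M^d∕M⁴)·dirSq φ (periodBox N) ≤ q₂²·‖X₀‖_w²`, (DL1) `(M^d∕M⁴)·dirL1 φ (periodBox N) ≤ q₁·‖X₀‖_w²`
(`q₂ ≥ 0`).  CONCLUSION: the decomposition `X := X₀ = (X₀ − X_N) + X_N`, `X_N := rightInvW …(φ)`, with `‖X_N‖_w ≤ √(c₁+c₂)·q₂·‖X₀‖_w` and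
`(ε∕M²)·Σ‖curl X_N‖ ≤ (ε·c₃·q₁)·‖X₀‖_w²` — the normal sizes are THEOREMS of (R1)–(R3). [folklore] -/
theorem decomp_of_directLetters_generic [Nonempty n] {L N : ℕ} [NeZero L] [NeZero N] (hL : 2 ≤ L) (k : ℕ) {ε : ℝ} (hε : 0 < ε)
    (hls : LevelSmall d L k (ε / ((L : ℝ) ^ (k + 1)) ^ 2)) (hθl : thetaLoc d L * ε < 1) (hε1 : ε ≤ 1)
    {Us U' : Site d → Fin d → (Matrix n n ℂ)ˣ} (hUs : Us ∈ sfClass d L N ε (k + 1))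
    (𝒯 : ℕ → (Site d → Fin d → (Matrix n n ℂ)ˣ) → Set (Site d → Fin d → Matrix n n ℂ)) (hTs : ∀ Y ∈ 𝒯 k Us, IsSkewDir Y)
    {u : Site d → (Matrix n n ℂ)ˣ} {X₀ : Site d → Fin d → Matrix n n ℂ} {α₀ q₂ q₁ : ℝ} (hq₂ : 0 ≤ q₂)
    (hu : IsUnitarySite u) (hgauge : gaugeAct u U' = vary Us X₀ 1) (hXs : IsSkewDir X₀) (hXP : IsPeriodicDir X₀ ((N * L ^ (k + 1) : ℕ) : ℤ))
    (hα₀ : 0 ≤ α₀) (hsup : ∀ (x : Site d) (μ : Fin d), ‖X₀ x μ‖ ≤ α₀)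
    (hslice : ∀ (hWu : IsUnitaryCfg Us) (hx : 0 ≤ ε / ((L : ℝ) ^ (k + 1)) ^ 2) (hs : LevelSmall d L k (ε / ((L : ℝ) ^ (k + 1)) ^ 2))
        (hWx : SmallField Us (ε / ((L : ℝ) ^ (k + 1)) ^ 2))
        (hθ : cruxC d L * (((L : ℝ) ^ (k + 1)) ^ 2 * (ε / ((L : ℝ) ^ (k + 1)) ^ 2)) < 1)
        (hφ : IsSkewDir (dirIter L (k + 1) Us X₀)),
      (fun y μ => X₀ y μ - rightInvW hL k hWu hx hs hWx N hθ hφ y μ) ∈ 𝒯 k Us)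
    (hDL2 : ((L : ℝ) ^ (k + 1)) ^ d / ((L : ℝ) ^ (k + 1)) ^ 4 * dirSq (dirIter L (k + 1) Us X₀) (periodBox (d := d) N)
      ≤ q₂ ^ 2 * energyNormW L (k + 1) Us X₀ (periodBox (d := d) (N * L ^ (k + 1))) ^ 2)
    (hDL1 : ((L : ℝ) ^ (k + 1)) ^ d / ((L : ℝ) ^ (k + 1)) ^ 4 * dirL1 (dirIter L (k + 1) Us X₀) (periodBox (d := d) N)
      ≤ q₁ * energyNormW L (k + 1) Us X₀ (periodBox (d := d) (N * L ^ (k + 1))) ^ 2) :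
    ∃ (u : Site d → (Matrix n n ℂ)ˣ) (X XT XN : Site d → Fin d → Matrix n n ℂ) (α ν κ : ℝ),
      IsUnitarySite u ∧ IsSkewDir X ∧ IsPeriodicDir X ((N * L ^ (k + 1) : ℕ) : ℤ) ∧ 0 ≤ α ∧ (∀ x μ, ‖X x μ‖ ≤ α) ∧
      gaugeAct u U' = vary Us X 1 ∧
      X = XT + XN ∧ XT ∈ 𝒯 k Us ∧ IsSkewDir XN ∧ 0 ≤ ν ∧
      energyNormW L (k + 1) Us XN (periodBox (d := d) (N * L ^ (k + 1)))
        ≤ ν * energyNormW L (k + 1) Us X (periodBox (d := d) (N * L ^ (k + 1))) ∧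
      ε / ((L : ℝ) ^ (k + 1)) ^ 2 * (∑ p ∈ perWin d (N * L ^ (k + 1)), ‖curl Us XN p‖)
        ≤ κ * energyNormW L (k + 1) Us X (periodBox (d := d) (N * L ^ (k + 1))) ^ 2 ∧
      α = α₀ ∧
      ν = Real.sqrt (l2C d L / (1 - thetaLoc d L * ε) ^ 2 + curl2C d L / (1 - thetaLoc d L * ε) ^ 2) * q₂ ∧
      κ = ε * (curl1C d L / (1 - thetaLoc d L * ε)) * q₁ := by
  have hL1 : 1 ≤ L := by omega
  have hL1r : (1 : ℝ) ≤ L := by exact_mod_cast hL1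
  -- the W6 regime numerics and the route-Π constants
  have hθc : cruxC d L * ε < 1 := lt_of_le_of_lt (mul_le_mul_of_nonneg_right (cruxC_le_thetaLoc d L) hε.le) hθl
  have h1θl : 0 < 1 - thetaLoc d L * ε := by linarith
  set c₁ : ℝ := l2C d L / (1 - thetaLoc d L * ε) ^ 2 with hc₁def
  set c₂ : ℝ := curl2C d L / (1 - thetaLoc d L * ε) ^ 2 with hc₂def
  set c₃ : ℝ := curl1C d L / (1 - thetaLoc d L * ε) with hc₃def
  have hc₁ : 0 ≤ c₁ := by have := l2C_nonneg d L; positivity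
  have hc₂ : 0 ≤ c₂ := by have := curl2C_nonneg d L; positivity
  have hc₃ : 0 ≤ c₃ := by have := curl1C_nonneg d L; positivity
  -- class data of `U♯` and the radius identities
  obtain ⟨hWu, hWP, hWx⟩ := hUs
  have hT : ((tower L N (k + 1) : ℕ) : ℤ) = ((N * L ^ (k + 1) : ℕ) : ℤ) := by
    rw [NE3FramePotBoundW.tower_eq_pow_mul, Nat.mul_comm]
  have hWPt : IsPeriodicCfg Us ((tower L N (k + 1) : ℕ) : ℤ) := by rw [hT]; exact hWP
  have hx : 0 ≤ ε / ((L : ℝ) ^ (k + 1)) ^ 2 := by positivity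
  have hxM : ((L : ℝ) ^ (k + 1)) ^ 2 * (ε / ((L : ℝ) ^ (k + 1)) ^ 2) = ε := (levelRadius_rescale hL1 ε k).2
  set M : ℝ := (L : ℝ) ^ (k + 1) with hMdef
  have hM0 : 0 < M := by positivity
  have hθ : cruxC d L * (M ^ 2 * (ε / M ^ 2)) < 1 := by rw [hxM]; exact hθc
  have hθlM : thetaLoc d L * (M ^ 2 * (ε / M ^ 2)) < 1 := by rw [hxM]; exact hθl
  have hεM : M ^ 2 * (ε / M ^ 2) ≤ 1 := by rw [hxM]; exact hε1
  -- the coarse datum `φ`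
  have hφs : IsSkewDir (dirIter L (k + 1) Us X₀) := dirIter_skew hL1 k hWu hx hls hWx hXs
  have hTm := hslice hWu hx hls hWx hθ hφs
  -- the letters (R1)–(R3) of `Nn := rightInvW … φ`
  have hR1 := rightInvW_R1 hL k hWu hWPt hx hls hWx hθ hθlM hεM hφs
  have hR2 := curlSq_rightInvW_le hL k hWu hWPt hx hls hWx hθ hθlM hεM hφs
  have hR3 := sum_norm_curl_rightInvW_le hL k hWu hWPt hx hls hWx hθ hθlM hεM hφs
  rw [hxM] at hR1 hR2 hR3
  set Nn := rightInvW hL k hWu hx hls hWx N hθ hφs with hNndef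
  set F := periodBox (d := d) (N * L ^ (k + 1)) with hF
  set φ := dirIter L (k + 1) Us X₀ with hφdef
  -- skewness of `Nn` from the slice part
  have hTsk : IsSkewDir (fun y μ => X₀ y μ - Nn y μ) := hTs _ hTm
  have hNsk : IsSkewDir Nn := fun y μ => by
    have e : Nn y μ = X₀ y μ - (X₀ y μ - Nn y μ) := (sub_sub_cancel _ _).symm
    rw [e]; exact (skewAdjoint (Matrix n n ℂ)).sub_mem (hXs y μ) (hTsk y μ)
  -- energies
  set EX : ℝ := energyNormW L (k + 1) Us X₀ F with hEX
  set EN : ℝ := energyNormW L (k + 1) Us Nn F with hEN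
  have hEX0 : 0 ≤ EX := energyNormW_nonneg _ _ _ _ _
  have hEN0 : 0 ≤ EN := energyNormW_nonneg _ _ _ _ _
  have hdφ0 : 0 ≤ dirSq φ (periodBox (d := d) N) := dirSq_nonneg _ _
  -- (DL2) ⇒ `EN² ≤ (c₁+c₂)·(M^d/M⁴)·dirSq φ ≤ (c₁+c₂) q₂² EX²`
  have hENsq : EN ^ 2 = curlSq Us Nn F + (M⁻¹) ^ 2 * dirSq Nn F := by
    rw [hEN]; unfold NE3EnergyWeightedShapes.energyNormW
    rw [Real.sq_sqrt (energySq_nonneg L (k + 1) Us Nn F)]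
  have hEN2 : EN ^ 2 ≤ (c₁ + c₂) * (q₂ ^ 2 * EX ^ 2) := by
    have h1 : (M⁻¹) ^ 2 * dirSq Nn F ≤ (M⁻¹) ^ 2 * (c₁ * (M ^ d / M ^ 2) * dirSq φ (periodBox (d := d) N)) :=
      mul_le_mul_of_nonneg_left hR1 (by positivity)
    have h2 : (M⁻¹) ^ 2 * (c₁ * (M ^ d / M ^ 2) * dirSq φ (periodBox (d := d) N)) = c₁ * (M ^ d / M ^ 4 * dirSq φ (periodBox (d := d) N)) := by
      field_simp
    have h2' : c₂ * (M ^ d / M ^ 4) * dirSq φ (periodBox (d := d) N) = c₂ * (M ^ d / M ^ 4 * dirSq φ (periodBox (d := d) N)) := by ring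
    have h3 : EN ^ 2 ≤ (c₁ + c₂) * (M ^ d / M ^ 4 * dirSq φ (periodBox (d := d) N)) := by
      rw [hENsq]
      have h12 := add_le_add hR2 h1
      rw [h2, h2'] at h12
      linarith
    exact h3.trans (by nlinarith [hDL2, hc₁, hc₂])
  have hN1 : EN ≤ Real.sqrt (c₁ + c₂) * q₂ * EX := by
    have hr : 0 ≤ Real.sqrt (c₁ + c₂) * q₂ * EX := mul_nonneg (mul_nonneg (Real.sqrt_nonneg _) hq₂) hEX0
    have hs2 : Real.sqrt (c₁ + c₂) ^ 2 = c₁ + c₂ := Real.sq_sqrt (add_nonneg hc₁ hc₂)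
    have hsq' : EN ^ 2 ≤ (Real.sqrt (c₁ + c₂) * q₂ * EX) ^ 2 := by
      have e : (Real.sqrt (c₁ + c₂) * q₂ * EX) ^ 2 = Real.sqrt (c₁ + c₂) ^ 2 * (q₂ ^ 2 * EX ^ 2) := by ring
      rw [e, hs2]; exact hEN2
    exact (pow_le_pow_iff_left₀ hEN0 hr (by norm_num : (2 : ℕ) ≠ 0)).1 hsq'
  -- (DL1) ⇒ the ℓ¹-curl letter
  have hN2 : ε / M ^ 2 * (∑ p ∈ perWin d (N * L ^ (k + 1)), ‖curl Us Nn p‖) ≤ ε * c₃ * q₁ * EX ^ 2 := by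
    have h1 : ε / M ^ 2 * (∑ p ∈ perWin d (N * L ^ (k + 1)), ‖curl Us Nn p‖)
        ≤ ε / M ^ 2 * (c₃ * (M ^ d / M ^ 2) * dirL1 φ (periodBox (d := d) N)) := mul_le_mul_of_nonneg_left hR3 (by positivity)
    have h2 : ε / M ^ 2 * (c₃ * (M ^ d / M ^ 2) * dirL1 φ (periodBox (d := d) N)) = ε * c₃ * (M ^ d / M ^ 4 * dirL1 φ (periodBox (d := d) N)) := by
      field_simp
    rw [h2] at h1
    have h3 : ε * c₃ * (M ^ d / M ^ 4 * dirL1 φ (periodBox (d := d) N)) ≤ ε * c₃ * (q₁ * EX ^ 2) :=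
      mul_le_mul_of_nonneg_left hDL1 (by positivity)
    linarith
  refine ⟨u, X₀, fun y μ => X₀ y μ - Nn y μ, Nn, α₀, Real.sqrt (c₁ + c₂) * q₂, ε * c₃ * q₁, hu, hXs, hXP, hα₀, hsup, hgauge,
    ?_, hTm, hNsk, by positivity, hN1, hN2, rfl, rfl, rfl⟩
  funext y μ; simp only [Pi.add_apply, sub_add_cancel]

/-- **THE `hdecomp` BODY OVER `𝒯` FROM AN EXACT `𝒯`-SLICE REPRESENTATIVE RELATIVE TO AN ARBITRARY COARSE DATUM `φ`** — the same as `decomp_of_directLetters_generic` with the linearised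
average `dirIter L (k+1) U♯ X₀` replaced by ANY skew coarse field `φ`: slice condition `X₀ − rightInvW(φ) ∈ 𝒯 k U♯`, direct letters (DL1)∕(DL2) for `φ`, conclusion with `X_N := rightInvW(φ)`.
This is the junction the corner-free slice `𝒯_E` needs (memo ROAD-G99 §3.9 (S1″)): there `φ := dirIter X₀ − gaugeDir (cavgIter …) (log of the corner values of the gauge)` = the QUADRATIC remainder
of the iterated average between the fibres `V^{c}` and `V`, because elements of `𝒯_E` carry accumulated frames (`dirIter X_E ≠ 0`). [folklore] -/
theorem decomp_of_directLetters_coarse [Nonempty n] {L N : ℕ} [NeZero L] [NeZero N] (hL : 2 ≤ L) (k : ℕ) {ε : ℝ} (hε : 0 < ε)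
    (hls : LevelSmall d L k (ε / ((L : ℝ) ^ (k + 1)) ^ 2)) (hθl : thetaLoc d L * ε < 1) (hε1 : ε ≤ 1)
    {Us U' : Site d → Fin d → (Matrix n n ℂ)ˣ} (hUs : Us ∈ sfClass d L N ε (k + 1))
    (𝒯 : ℕ → (Site d → Fin d → (Matrix n n ℂ)ˣ) → Set (Site d → Fin d → Matrix n n ℂ)) (hTs : ∀ Y ∈ 𝒯 k Us, IsSkewDir Y)
    {φ : Site d → Fin d → Matrix n n ℂ} (hφs : IsSkewDir φ)
    {u : Site d → (Matrix n n ℂ)ˣ} {X₀ : Site d → Fin d → Matrix n n ℂ} {α₀ q₂ q₁ : ℝ} (hq₂ : 0 ≤ q₂)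
    (hu : IsUnitarySite u) (hgauge : gaugeAct u U' = vary Us X₀ 1) (hXs : IsSkewDir X₀) (hXP : IsPeriodicDir X₀ ((N * L ^ (k + 1) : ℕ) : ℤ))
    (hα₀ : 0 ≤ α₀) (hsup : ∀ (x : Site d) (μ : Fin d), ‖X₀ x μ‖ ≤ α₀)
    (hslice : ∀ (hWu : IsUnitaryCfg Us) (hx : 0 ≤ ε / ((L : ℝ) ^ (k + 1)) ^ 2) (hs : LevelSmall d L k (ε / ((L : ℝ) ^ (k + 1)) ^ 2))
        (hWx : SmallField Us (ε / ((L : ℝ) ^ (k + 1)) ^ 2))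
        (hθ : cruxC d L * (((L : ℝ) ^ (k + 1)) ^ 2 * (ε / ((L : ℝ) ^ (k + 1)) ^ 2)) < 1)
        (hφ : IsSkewDir φ),
      (fun y μ => X₀ y μ - rightInvW hL k hWu hx hs hWx N hθ hφ y μ) ∈ 𝒯 k Us)
    (hDL2 : ((L : ℝ) ^ (k + 1)) ^ d / ((L : ℝ) ^ (k + 1)) ^ 4 * dirSq φ (periodBox (d := d) N)
      ≤ q₂ ^ 2 * energyNormW L (k + 1) Us X₀ (periodBox (d := d) (N * L ^ (k + 1))) ^ 2)
    (hDL1 : ((L : ℝ) ^ (k + 1)) ^ d / ((L : ℝ) ^ (k + 1)) ^ 4 * dirL1 φ (periodBox (d := d) N)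
      ≤ q₁ * energyNormW L (k + 1) Us X₀ (periodBox (d := d) (N * L ^ (k + 1))) ^ 2) :
    ∃ (u : Site d → (Matrix n n ℂ)ˣ) (X XT XN : Site d → Fin d → Matrix n n ℂ) (α ν κ : ℝ),
      IsUnitarySite u ∧ IsSkewDir X ∧ IsPeriodicDir X ((N * L ^ (k + 1) : ℕ) : ℤ) ∧ 0 ≤ α ∧ (∀ x μ, ‖X x μ‖ ≤ α) ∧
      gaugeAct u U' = vary Us X 1 ∧
      X = XT + XN ∧ XT ∈ 𝒯 k Us ∧ IsSkewDir XN ∧ 0 ≤ ν ∧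
      energyNormW L (k + 1) Us XN (periodBox (d := d) (N * L ^ (k + 1)))
        ≤ ν * energyNormW L (k + 1) Us X (periodBox (d := d) (N * L ^ (k + 1))) ∧
      ε / ((L : ℝ) ^ (k + 1)) ^ 2 * (∑ p ∈ perWin d (N * L ^ (k + 1)), ‖curl Us XN p‖)
        ≤ κ * energyNormW L (k + 1) Us X (periodBox (d := d) (N * L ^ (k + 1))) ^ 2 ∧
      α = α₀ ∧
      ν = Real.sqrt (l2C d L / (1 - thetaLoc d L * ε) ^ 2 + curl2C d L / (1 - thetaLoc d L * ε) ^ 2) * q₂ ∧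
      κ = ε * (curl1C d L / (1 - thetaLoc d L * ε)) * q₁ := by
  have hL1 : 1 ≤ L := by omega
  have hL1r : (1 : ℝ) ≤ L := by exact_mod_cast hL1
  -- the W6 regime numerics and the route-Π constants
  have hθc : cruxC d L * ε < 1 := lt_of_le_of_lt (mul_le_mul_of_nonneg_right (cruxC_le_thetaLoc d L) hε.le) hθl
  have h1θl : 0 < 1 - thetaLoc d L * ε := by linarith
  set c₁ : ℝ := l2C d L / (1 - thetaLoc d L * ε) ^ 2 with hc₁def
  set c₂ : ℝ := curl2C d L / (1 - thetaLoc d L * ε) ^ 2 with hc₂def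
  set c₃ : ℝ := curl1C d L / (1 - thetaLoc d L * ε) with hc₃def
  have hc₁ : 0 ≤ c₁ := by have := l2C_nonneg d L; positivity
  have hc₂ : 0 ≤ c₂ := by have := curl2C_nonneg d L; positivity
  have hc₃ : 0 ≤ c₃ := by have := curl1C_nonneg d L; positivity
  -- class data of `U♯` and the radius identities
  obtain ⟨hWu, hWP, hWx⟩ := hUs
  have hT : ((tower L N (k + 1) : ℕ) : ℤ) = ((N * L ^ (k + 1) : ℕ) : ℤ) := by
    rw [NE3FramePotBoundW.tower_eq_pow_mul, Nat.mul_comm]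
  have hWPt : IsPeriodicCfg Us ((tower L N (k + 1) : ℕ) : ℤ) := by rw [hT]; exact hWP
  have hx : 0 ≤ ε / ((L : ℝ) ^ (k + 1)) ^ 2 := by positivity
  have hxM : ((L : ℝ) ^ (k + 1)) ^ 2 * (ε / ((L : ℝ) ^ (k + 1)) ^ 2) = ε := (levelRadius_rescale hL1 ε k).2
  set M : ℝ := (L : ℝ) ^ (k + 1) with hMdef
  have hM0 : 0 < M := by positivity
  have hθ : cruxC d L * (M ^ 2 * (ε / M ^ 2)) < 1 := by rw [hxM]; exact hθc
  have hθlM : thetaLoc d L * (M ^ 2 * (ε / M ^ 2)) < 1 := by rw [hxM]; exact hθl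
  have hεM : M ^ 2 * (ε / M ^ 2) ≤ 1 := by rw [hxM]; exact hε1
  -- the coarse datum `φ`
  have hTm := hslice hWu hx hls hWx hθ hφs
  -- the letters (R1)–(R3) of `Nn := rightInvW … φ`
  have hR1 := rightInvW_R1 hL k hWu hWPt hx hls hWx hθ hθlM hεM hφs
  have hR2 := curlSq_rightInvW_le hL k hWu hWPt hx hls hWx hθ hθlM hεM hφs
  have hR3 := sum_norm_curl_rightInvW_le hL k hWu hWPt hx hls hWx hθ hθlM hεM hφs
  rw [hxM] at hR1 hR2 hR3
  set Nn := rightInvW hL k hWu hx hls hWx N hθ hφs with hNndef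
  set F := periodBox (d := d) (N * L ^ (k + 1)) with hF
  -- skewness of `Nn` from the slice part
  have hTsk : IsSkewDir (fun y μ => X₀ y μ - Nn y μ) := hTs _ hTm
  have hNsk : IsSkewDir Nn := fun y μ => by
    have e : Nn y μ = X₀ y μ - (X₀ y μ - Nn y μ) := (sub_sub_cancel _ _).symm
    rw [e]; exact (skewAdjoint (Matrix n n ℂ)).sub_mem (hXs y μ) (hTsk y μ)
  -- energies
  set EX : ℝ := energyNormW L (k + 1) Us X₀ F with hEX
  set EN : ℝ := energyNormW L (k + 1) Us Nn F with hEN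
  have hEX0 : 0 ≤ EX := energyNormW_nonneg _ _ _ _ _
  have hEN0 : 0 ≤ EN := energyNormW_nonneg _ _ _ _ _
  have hdφ0 : 0 ≤ dirSq φ (periodBox (d := d) N) := dirSq_nonneg _ _
  -- (DL2) ⇒ `EN² ≤ (c₁+c₂)·(M^d/M⁴)·dirSq φ ≤ (c₁+c₂) q₂² EX²`
  have hENsq : EN ^ 2 = curlSq Us Nn F + (M⁻¹) ^ 2 * dirSq Nn F := by
    rw [hEN]; unfold NE3EnergyWeightedShapes.energyNormW
    rw [Real.sq_sqrt (energySq_nonneg L (k + 1) Us Nn F)]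
  have hEN2 : EN ^ 2 ≤ (c₁ + c₂) * (q₂ ^ 2 * EX ^ 2) := by
    have h1 : (M⁻¹) ^ 2 * dirSq Nn F ≤ (M⁻¹) ^ 2 * (c₁ * (M ^ d / M ^ 2) * dirSq φ (periodBox (d := d) N)) :=
      mul_le_mul_of_nonneg_left hR1 (by positivity)
    have h2 : (M⁻¹) ^ 2 * (c₁ * (M ^ d / M ^ 2) * dirSq φ (periodBox (d := d) N)) = c₁ * (M ^ d / M ^ 4 * dirSq φ (periodBox (d := d) N)) := by
      field_simp
    have h2' : c₂ * (M ^ d / M ^ 4) * dirSq φ (periodBox (d := d) N) = c₂ * (M ^ d / M ^ 4 * dirSq φ (periodBox (d := d) N)) := by ring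
    have h3 : EN ^ 2 ≤ (c₁ + c₂) * (M ^ d / M ^ 4 * dirSq φ (periodBox (d := d) N)) := by
      rw [hENsq]
      have h12 := add_le_add hR2 h1
      rw [h2, h2'] at h12
      linarith
    exact h3.trans (by nlinarith [hDL2, hc₁, hc₂])
  have hN1 : EN ≤ Real.sqrt (c₁ + c₂) * q₂ * EX := by
    have hr : 0 ≤ Real.sqrt (c₁ + c₂) * q₂ * EX := mul_nonneg (mul_nonneg (Real.sqrt_nonneg _) hq₂) hEX0
    have hs2 : Real.sqrt (c₁ + c₂) ^ 2 = c₁ + c₂ := Real.sq_sqrt (add_nonneg hc₁ hc₂)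
    have hsq' : EN ^ 2 ≤ (Real.sqrt (c₁ + c₂) * q₂ * EX) ^ 2 := by
      have e : (Real.sqrt (c₁ + c₂) * q₂ * EX) ^ 2 = Real.sqrt (c₁ + c₂) ^ 2 * (q₂ ^ 2 * EX ^ 2) := by ring
      rw [e, hs2]; exact hEN2
    exact (pow_le_pow_iff_left₀ hEN0 hr (by norm_num : (2 : ℕ) ≠ 0)).1 hsq'
  -- (DL1) ⇒ the ℓ¹-curl letter
  have hN2 : ε / M ^ 2 * (∑ p ∈ perWin d (N * L ^ (k + 1)), ‖curl Us Nn p‖) ≤ ε * c₃ * q₁ * EX ^ 2 := by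
    have h1 : ε / M ^ 2 * (∑ p ∈ perWin d (N * L ^ (k + 1)), ‖curl Us Nn p‖)
        ≤ ε / M ^ 2 * (c₃ * (M ^ d / M ^ 2) * dirL1 φ (periodBox (d := d) N)) := mul_le_mul_of_nonneg_left hR3 (by positivity)
    have h2 : ε / M ^ 2 * (c₃ * (M ^ d / M ^ 2) * dirL1 φ (periodBox (d := d) N)) = ε * c₃ * (M ^ d / M ^ 4 * dirL1 φ (periodBox (d := d) N)) := by
      field_simp
    rw [h2] at h1
    have h3 : ε * c₃ * (M ^ d / M ^ 4 * dirL1 φ (periodBox (d := d) N)) ≤ ε * c₃ * (q₁ * EX ^ 2) :=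
      mul_le_mul_of_nonneg_left hDL1 (by positivity)
    linarith
  refine ⟨u, X₀, fun y μ => X₀ y μ - Nn y μ, Nn, α₀, Real.sqrt (c₁ + c₂) * q₂, ε * c₃ * q₁, hu, hXs, hXP, hα₀, hsup, hgauge,
    ?_, hTm, hNsk, by positivity, hN1, hN2, rfl, rfl, rfl⟩
  funext y μ; simp only [Pi.add_apply, sub_add_cancel]

end

end Summit.QuantumFields.BalabanUV.T4Continuum.NE7DecompOfDirectLettersSlice
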